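import Summits.Ventures.QEC.CircuitDistance.PortXSector
import Summits.Ventures.QEC.CircuitDistance.SchedZTable
import Summits.Ventures.QEC.CircuitDistance.SchedBridge
import HarnessLib

/-!
# Q4 lane, ₛ-spine (9X): the `X`-SECTOR THEOREM for any CNOT order — tables (shape-correct for `σ`) + covered UNSAT leaves +
# orbit-complete word list ⇒ no undetectable `X`-logical fault set of `≤ w` operations in the `N₀`-cycle circuit of `σ`
# (venture QEC, experiment cell CDX, seat qec-cdx-type-2; `PortXSector.lean` re-pointed to `xDEMₛ σ`/`Gen.*` under
# `hσ : σ.CycleFacts S`; proofs verbatim; nothing here asserts a value of `d_circ`)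

Reused unchanged (order-free): `LeafEntry`, `faultTranslateEquiv`/`detTranslateEquiv`/`genTranslateEquiv`, the DECIDABLE coverage
checker `XTable.covers` (it reads `XTable.detFast` only), `xNontrivial_add_stab`, the abstract `Fibre.*` layer. Re-pointed:
`xDetₛ_translate`, `xSymmₛ` (translations are symmetries of `xDEMₛ`), `xDetₛ_eq_of_xKind`/`_eq_empty_of_xKind`, **`covers_soundₛ`**,
`silent_xDEMₛ`, **`no_xLogical_of_leavesₛ (hσ)`**, **`not_hasAtₛ_of_sectors`**.
-/

namespace Summit.Ventures.QEC.CircuitDistance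

open Literature.InformationTheory.QuantumCodes

variable {ℓ m : ℕ} [NeZero ℓ] [NeZero m]

/-! ## Translations as symmetries of the `X`-sector DEM of a scheduled circuit -/

/-- Translated `X`-columns, any order (cf. `xDet_translate`). -/
theorem xDetₛ_translate (σ : SMSchedule) (S : SMCode ℓ m) (Nc : ℕ) (f : Fault ℓ m) (t : BB.Mono ℓ m) :
    xDetₛ σ S Nc (f.translate t) = (xDetₛ σ S Nc f).map (detTranslateEquiv t).toEmbedding := by
  ext ⟨s, j⟩
  rw [Finset.mem_map_equiv]
  have hsymm : (detTranslateEquiv t).symm (s, j) = (s, j + -t) := rfl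
  rw [hsymm]
  simp only [xDetₛ, Finset.mem_filter, Finset.mem_product, Finset.mem_range, Finset.mem_univ, and_true,
    Gen.detZ_translate_singleton, sub_eq_add_neg]

/-- **Translations are symmetries of the `X`-sector DEM** of any order (cf. `xSymm`). -/
def xSymmₛ (σ : SMSchedule) (S : SMCode ℓ m) (T : XTable ℓ m) (Nc : ℕ) (t : BB.Mono ℓ m) :
    Fibre.Symmetry (xDEMₛ σ S T Nc) (scope Nc) where
  onCol := faultTranslateEquiv t
  onDet := detTranslateEquiv t
  onGen := genTranslateEquiv t
  det_map f := xDetₛ_translate σ S Nc f t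
  cls_map f := by
    show ((f.translate t).xKind.bind fun ki => (T.cls ki.1).map (trQ ki.2)) =
      (f.xKind.bind fun ki => (T.cls ki.1).map (trQ ki.2)).map (genTranslateEquiv t)
    rw [Fault.xKind_translate]
    rcases f.xKind with _ | ⟨k, i⟩
    · rfl
    · simp only [Option.map_some, Option.bind_some, Option.map_map]
      cases T.cls k with
      | none => rfl
      | some g => simp only [Option.map_some, Function.comp, genTranslateEquiv_apply, trQ_add]
  scope_map f := by
    show (1 ≤ (f.translate t).cyc ∧ (f.translate t).cyc ≤ Nc) ↔ (1 ≤ f.cyc ∧ f.cyc ≤ Nc)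
    rw [Fault.cyc_translate]

/-! ## Coverage (the checker `XTable.covers` of the tree is order-free and reused) -/

/-- The `X`-column of a fault equals that of its representative (cf. `xDet_eq_of_xKind`). -/
theorem xDetₛ_eq_of_xKind (σ : SMSchedule) (S : SMCode ℓ m) (Nc : ℕ) (f : Fault ℓ m) {k : XKind} {i : BB.Mono ℓ m}
    (h : f.xKind = some (k, i)) : xDetₛ σ S Nc f = xDetₛ σ S Nc (k.fault f.cyc i) := by
  unfold xDetₛ; congr 1; funext p; rw [(Gen.xColumn_eq_of_xKind S Nc (allEventsₛ σ Nc) f h).1]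

/-- A fault without `X`-part has an empty `X`-column (cf. `xDet_eq_empty_of_xKind`). -/
theorem xDetₛ_eq_empty_of_xKind (σ : SMSchedule) (S : SMCode ℓ m) (Nc : ℕ) (f : Fault ℓ m) (h : f.xKind = none) :
    xDetₛ σ S Nc f = ∅ := by
  unfold xDetₛ
  rw [Finset.filter_eq_empty_iff]
  intro p _
  rw [(Gen.xColumn_zero_of_xKind S Nc (allEventsₛ σ Nc) f h).1]
  exact Bool.false_ne_true

/-- **Coverage soundness**, any order with the cycle facts (cf. `covers_sound`): a passed (order-free) coverage check against a
table that is shape-correct FOR `σ` is `Fibre.Covers` for the `X`-sector DEM of `σ`'s circuit. -/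
theorem covers_soundₛ {σ : SMSchedule} {S : SMCode ℓ m} (hσ : σ.CycleFacts S) (T : XTable ℓ m) (hS : T.ShapeCorrectₛ σ S)
    (Nc : ℕ) (e : LeafEntry ℓ m) (h : T.covers S Nc e = true) :
    Fibre.Covers (xDEMₛ σ S T Nc) (scope Nc) encDet e.word e.leaf := by
  unfold XTable.covers at h
  simp only [Bool.and_eq_true, decide_eq_true_eq, List.all_eq_true] at h
  obtain ⟨hlen, hall⟩ := h
  refine ⟨encDet_injective, hlen, fun f hf j hcls => ?_, fun f hf hcls => ?_⟩
  · obtain ⟨h₁, h₂⟩ := hf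
    change (f.xKind.bind fun ki => (T.cls ki.1).map (trQ ki.2)) = some e.word[j] at hcls
    rcases hk : f.xKind with _ | ⟨k, i⟩
    · rw [hk] at hcls; simp at hcls
    · rw [hk, Option.bind_some] at hcls
      have hmem : (k, i) ∈ XKind.all.product (monoList ℓ m) :=
        List.pair_mem_product.2 ⟨XKind.mem_all k (fun lay => Fault.xKind_ne_zero hk lay), mem_monoList i⟩
      have hki := hall (k, i) hmem
      simp only [hcls] at hki
      rw [List.all_eq_true] at hki
      have hj := hki j (List.mem_range.2 j.2)
      simp only [Bool.or_eq_true, Bool.not_eq_true', decide_eq_false_iff_not, List.all_eq_true, List.any_eq_true,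
        decide_eq_true_eq] at hj
      rcases hj with hj | hj
      · exact absurd (List.getElem?_eq_getElem j.2) hj
      · obtain ⟨c, hc, hcc⟩ := hj (f.cyc - 1) (List.mem_range.2 (by omega))
        refine ⟨c, hc, ?_⟩
        rw [hcc, Nat.sub_add_cancel h₁, XTable.detFast_eq_xDetₛ hσ (hS k (XKind.mem_all k (fun lay => Fault.xKind_ne_zero hk lay)))
          Nc i f.cyc h₁ h₂, ← xDetₛ_eq_of_xKind σ S Nc f hk]
        rfl
  · obtain ⟨h₁, h₂⟩ := hf
    change (f.xKind.bind fun ki => (T.cls ki.1).map (trQ ki.2)) = none at hcls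
    rcases hk : f.xKind with _ | ⟨k, i⟩
    · exact Or.inl (xDetₛ_eq_empty_of_xKind σ S Nc f hk)
    · rw [hk, Option.bind_some] at hcls
      have hkall : k ∈ XKind.all := XKind.mem_all k (fun lay => Fault.xKind_ne_zero hk lay)
      have hmem : (k, i) ∈ XKind.all.product (monoList ℓ m) := List.pair_mem_product.2 ⟨hkall, mem_monoList i⟩
      have hki := hall (k, i) hmem
      simp only [hcls] at hki
      rw [List.all_eq_true] at hki
      have hc := hki (f.cyc - 1) (List.mem_range.2 (by omega))
      simp only [Bool.or_eq_true, decide_eq_true_eq, List.any_eq_true] at hc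
      have hcol : (T.detFast S Nc k i (f.cyc - 1 + 1)).image encDet = (xDetₛ σ S Nc f).image encDet := by
        rw [Nat.sub_add_cancel h₁, XTable.detFast_eq_xDetₛ hσ (hS k hkall) Nc i f.cyc h₁ h₂, ← xDetₛ_eq_of_xKind σ S Nc f hk]
      rcases hc with hc | ⟨c, hcn, hcc⟩
      · left
        rw [hcol, Finset.image_eq_empty] at hc
        exact hc
      · right
        exact ⟨c, hcn, by rw [hcc, hcol]; rfl⟩

/-! ## Silence -/

/-- An undetectable fault set of `σ`'s circuit is silent in its `X`-sector DEM (cf. `silent_xDEM`). -/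
theorem silent_xDEMₛ (σ : SMSchedule) (S : SMCode ℓ m) (T : XTable ℓ m) (Nc : ℕ) (F : Finset (Fault ℓ m))
    (hU : Gen.Undetectable S Nc (allEventsₛ σ Nc) F) : Fibre.Silent (xDEMₛ σ S T Nc) F := by
  intro d
  obtain ⟨s, j⟩ := d
  show Even ((F.filter fun f => (s, j) ∈ xDetₛ σ S Nc f).card)
  have hdet := (hU.2 (s + 1) j).2
  rw [Gen.detZ_eq_bsum] at hdet
  unfold bsum at hdet
  have hfilt : (F.filter fun f => (s, j) ∈ xDetₛ σ S Nc f) =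
      F.filter fun f => s < Nc + 2 ∧ Gen.detZ S Nc (allEventsₛ σ Nc) {f} (s + 1) j = true := by
    apply Finset.filter_congr
    intro f _
    simp [xDetₛ]
  rw [hfilt]
  by_cases hs : s < Nc + 2
  · simp only [hs, true_and]
    rw [Nat.even_iff]
    rcases Nat.mod_two_eq_zero_or_one (F.filter fun f => Gen.detZ S Nc (allEventsₛ σ Nc) {f} (s + 1) j = true).card with h0 | h1
    · exact h0
    · rw [h1] at hdet; simp at hdet
  · have : (F.filter fun f => s < Nc + 2 ∧ Gen.detZ S Nc (allEventsₛ σ Nc) {f} (s + 1) j = true) = ∅ :=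
      Finset.filter_eq_empty_iff.2 (fun f _ h => hs h.1)
    rw [this, Finset.card_empty]
    exact ⟨0, rfl⟩

/-! ## The sector theorem -/

/-- **`X`-SECTOR THEOREM for any CNOT order with the cycle facts** (cf. `no_xLogical_of_leaves`): table shape-correct FOR `σ` and
class-correct; every listed leaf well-formed, covered and UNSAT with weight `w` and budget `≤ 1`; the list COMPLETE up to translation
for `X`-nontrivial words of weight `≤ w` ⇒ no undetectable fault set of `≤ w` operations of the `N₀`-cycle circuit of `σ` has an
`X`-nontrivial residual. -/
theorem no_xLogical_of_leavesₛ {σ : SMSchedule} {S : SMCode ℓ m} (hσ : σ.CycleFacts S) (T : XTable ℓ m)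
    (hS : T.ShapeCorrectₛ σ S) (hC : T.ClassCorrect S) (N₀ w : ℕ) (leaves : List (LeafEntry ℓ m))
    (hwf : ∀ e ∈ leaves, e.leaf.wf = true ∧ T.covers S N₀ e = true ∧ e.word.Nodup ∧
      e.leaf.w = w ∧ e.leaf.budget ≤ 1 ∧
      (Census.CNFEncode.cnfEncodeAny e.leaf.n e.leaf.rows e.leaf.us e.leaf.w).Unsat)
    (hcomplete : ∀ x : Finset (Finset (BB.Mono ℓ m ⊕ BB.Mono ℓ m)), XNontrivial S (∑ g ∈ x, indic g) → x.card ≤ w →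
      ∃ e ∈ leaves, ∃ t : BB.Mono ℓ m, x = (e.word.map (trQ t)).toFinset) :
    ¬ ∃ F : Finset (Fault ℓ m), Gen.Undetectable S N₀ (allEventsₛ σ N₀) F ∧
        Gen.dataX S (allEventsₛ σ N₀) F ∉ rowSpace S.toCode.HX ∧ faultCount F ≤ w := by
  classical
  rintro ⟨F, hU, hL, hw⟩
  obtain ⟨F₁, hR, hcard, himg, hX, hZ, hdX, hdZ⟩ := Gen.exists_reduced S N₀ (allEventsₛ σ N₀) F
  have hU₁ : Gen.Undetectable S N₀ (allEventsₛ σ N₀) F₁ := by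
    refine ⟨fun f' hf' => ?_, fun t i => ⟨?_, ?_⟩⟩
    · have : f'.loc ∈ F.image Fault.loc := himg (Finset.mem_image_of_mem _ hf')
      obtain ⟨f, hf, hfl⟩ := Finset.mem_image.1 this
      rw [← Fault.ev_eq_of_loc_eq hfl]; exact hU.1 f hf
    · rw [hX]; exact (hU.2 t i).1
    · rw [hZ]; exact (hU.2 t i).2
  have hNT : XNontrivial S (Gen.dataX S (allEventsₛ σ N₀) F₁) := by
    refine ⟨(residual_syndrome_zeroₛ hσ N₀ F₁ hU₁).1, ?_⟩
    rw [hdX]; exact hL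
  have hscope : ∀ f ∈ F₁, f ∈ scope (ℓ := ℓ) (m := m) N₀ := by
    intro f hf
    have := hU₁.1 f hf
    rw [hσ.mem_allEventsₛ_iff, Fault.ev_cyc] at this
    exact this
  have key := Fibre.no_silent_nontrivial (xDEMₛ σ S T N₀) (scope N₀) (classHyp_xDEMₛ hσ T hS hC N₀) (XNontrivial S)
    (fun v s hs => xNontrivial_add_stab S v s hs) w ?_ F₁ hscope (hcard.trans hw) (silent_xDEMₛ σ S T N₀ F₁ hU₁)
  · apply key
    show XNontrivial S (∑ f ∈ F₁, Gen.dataX S (allEventsₛ σ N₀) {f})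
    rw [← Gen.dataX_eq_sum]; exact hNT
  -- every nontrivial word of weight ≤ w has an UNSAT leaf, up to translation
  intro x hx hxw
  obtain ⟨e, he, t, rfl⟩ := hcomplete x hx hxw
  obtain ⟨hwfe, hcov, hnd, hwe, hb, hunsat⟩ := hwf e he
  have hcovers := covers_soundₛ hσ T hS N₀ e hcov
  have hlen : e.word.length = e.leaf.k := hcovers.2.1
  have hmap : (e.word.map (trQ t)).toFinset = e.word.toFinset.map (xSymmₛ σ S T N₀ t).onGen.toEmbedding := by
    ext g
    simp only [List.mem_toFinset, List.mem_map, Finset.mem_map_equiv]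
    show (∃ a, a ∈ e.word ∧ trQ t a = g) ↔ (genTranslateEquiv t).symm g ∈ e.word
    constructor
    · rintro ⟨a, ha, rfl⟩
      have : (genTranslateEquiv t).symm (genTranslateEquiv t a) = a := Equiv.symm_apply_apply _ _
      rw [genTranslateEquiv_apply] at this; rw [this]; exact ha
    · intro hg
      refine ⟨(genTranslateEquiv t).symm g, hg, ?_⟩
      rw [← genTranslateEquiv_apply, Equiv.apply_symm_apply]
  rw [hmap, Finset.card_map, List.toFinset_card_of_nodup hnd, hlen,
    Fibre.tightRealisable_map_iff (xDEMₛ σ S T N₀) (scope N₀) (xSymmₛ σ S T N₀ t)]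
  have hbud : w - e.leaf.k = e.leaf.budget := by unfold Fibre.Leaf.budget; rw [hwe]
  rw [hbud]
  exact Fibre.not_tightRealisable_of_leaf (xDEMₛ σ S T N₀) (scope N₀) encDet e.word hnd e.leaf hcovers hwfe hunsat hb

/-- **Sector assembly** for any order (cf. `not_hasAt_of_sectors`): both sector exclusions give the weight exclusion. -/
theorem not_hasAtₛ_of_sectors (σ : SMSchedule) (S : SMCode ℓ m) (N₀ w : ℕ)
    (hX : ¬ ∃ F : Finset (Fault ℓ m), Gen.Undetectable S N₀ (allEventsₛ σ N₀) F ∧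
      Gen.dataX S (allEventsₛ σ N₀) F ∉ rowSpace S.toCode.HX ∧ faultCount F ≤ w)
    (hZ : ¬ ∃ F : Finset (Fault ℓ m), Gen.Undetectable S N₀ (allEventsₛ σ N₀) F ∧
      Gen.dataZ S (allEventsₛ σ N₀) F ∉ rowSpace S.toCode.HZ ∧ faultCount F ≤ w) :
    ¬ HasLogicalFaultOfWeightAtMostAtₛ σ S N₀ w := by
  rintro ⟨F, hU, hL, hw⟩
  rcases (Gen.logicalError_iff S (allEventsₛ σ N₀) F).1 hL with h | h
  · exact hX ⟨F, hU, h, hw⟩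
  · exact hZ ⟨F, hU, h, hw⟩

end Summit.Ventures.QEC.CircuitDistance
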